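import Literature.Geometry.Symplectic.SteinDomain
import Literature.Topology.FourManifolds.Handles
import Literature.Topology.FourManifolds.SmoothOrientation
import Literature.Geometry.Symplectic.SteinMorseIndex
import Literature.Geometry.Symplectic.SteinMorsePerturbation
import HarnessLib

/-!
# Eliashberg's theorem on Stein handlebodies, I: 1-handlebodies are Stein domains

Topic `Literature/Geometry/Symplectic`; first named fact of the layer below Theorem 3 of
Akbulut–Matveyev (1998) (`AkbulutMatveyev.lean`, `Literature.Geometry.Symplectic.AkbulutMatveyev1998_thm3`,
fact seat `provefact-Literature.Symplectic.akbulut_matveyev`).  The printed proof of that theorem starts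
(§4): *"Let `Yᵢ` be a union of 0- and 1-handles in `Xᵢ`.  According to theorem of Eliashberg
(Theorem 2, above) `Yᵢ` is a PC manifold."*  Theorem 2 (1) there: *"Let
`X = B⁴ ∪ (1-handles) ∪ (2-handles)` be four-dimensional handlebody with one 0-handle and no 3-
or 4-handles.  Then: the standard PC structure on `B⁴` can be extended over 1-handles, so that
manifold `X₁ = B⁴ ∪ (1-handles)` has pseudo-convex boundary"* (Eliashberg 1990; Gompf 1998).
Gompf (1998), Thm. 1.3 (Eliashberg), compact case, as printed: *"A smooth, oriented, compact
4-manifold `X` admits a Stein structure if and only if it has a handle decomposition satisfying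
a, b and c"* — (a) each handle has index `≤ 2`, (b) each 2-handle is attached along a
Legendrian curve in the contact structure induced on the boundary of the underlying 0- and
1-handles, (c) with framing obtained from the canonical framing by adding a single left twist.
For a handle decomposition **without 2-handles** conditions (b) and (c) are vacuous, which gives
the fact recorded here:

* `Literature.Geometry.Symplectic.Gompf1998_thm13_noTwoHandles` — every compact oriented smooth 4-manifold with
  boundary admitting a handle decomposition with handles of index `≤ 1` only
  (`Literature.IsHandlebodyOfIndexLE 3 1`, the tree's Morse-theoretic handle vocabulary of
  `Handles.lean`: a Morse function adapted to the boundary all of whose critical points have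
  index `≤ 1`; Milnor 1963, Thm. 3.2) admits a Stein structure (`Literature.Geometry.Symplectic.IsSteinDomain`,
  `SteinDomain.lean`).

Rendering notes.  Orientability (`Literature.IsOrientable (𝓡∂ 4) W`, `SmoothOrientation.lean`) is
Gompf's standing hypothesis "oriented" and is necessary (a Stein structure is a complex
structure; the non-orientable `S¹ ×~ B³ = B⁴ ∪` a non-orientable 1-handle is not Stein).
Connectedness is not assumed (a disjoint union of Stein domains is a Stein domain for
`IsSteinDomain`: take the same maximal value of `φ` on every component; Gompf's `X` may be
disconnected, each component being `♮ⁿ S¹ × B³`), and the empty manifold is allowed (trivially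
Stein).  The conclusion in print is stronger (the Stein structure induces the given handle
decomposition, and realises any almost-complex structure up to homotopy); only existence is
recorded.  Part II of Eliashberg's theorem (2-handles along Legendrian knots with framing
`tb - 1`, AM Thm. 2 (2) / Gompf Thm. 1.3 (b)–(c)) needs 2-handle attachment along a prescribed
framed knot, not yet in the tree; its contact-geometric vocabulary is
`SteinBoundaryContact.lean`.

## References

* R. E. Gompf, *Handlebody construction of Stein surfaces*, Ann. of Math. 148 (1998), 619–693
  (arXiv:math/9803019), Thm. 1.3 (p. 6 of the arXiv version) and §2, first paragraph
  (`X₁ = ♮ⁿ S¹ × B³`). [Gompf1998]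
* Ya. Eliashberg, *Topological characterization of Stein manifolds of dimension > 2*, Internat.
  J. Math. 1 (1990), 29–46. [Eliashberg1990Stein]
* S. Akbulut, R. Matveyev, *A convex decomposition theorem for 4-manifolds*, IMRN 1998, no. 7,
  371–381 (arXiv:math/0010166), Thm. 2 (1) and §4. [AkbulutMatveyev1998]
-/

noncomputable section

open scoped Manifold ContDiff

namespace Literature.Geometry.Symplectic

/-- **Eliashberg's theorem, no 2-handles (Gompf 1998, Thm. 1.3; Akbulut–Matveyev 1998,
Thm. 2 (1)): compact oriented 4-dimensional 1-handlebodies are Stein domains.**  Gompf,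
Thm. 1.3 (compact case): *"A smooth, oriented, compact 4-manifold `X` admits a Stein structure
if and only if it has a handle decomposition satisfying a, b and c"*; for a handle
decomposition with handles of index `≤ 1` only, (a) holds and (b), (c) (conditions on the
2-handles) are vacuous.  Tree rendering: `W` a compact (Hausdorff, second countable) `C^∞`
4-manifold with boundary (model `𝓡∂ 4`), orientable (`Literature.Topology.FourManifolds.IsOrientable`), carrying a Morse
function adapted to `∂W` with all critical points of index `≤ 1`
(`Literature.IsHandlebodyOfIndexLE 3 1 W`); conclusion: `W` admits a Stein structure
(`IsSteinDomain W`; weaker than print, which also makes the Stein structure induce the given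
handles). [cite: Gompf1998, Thm. 1.3] -/
def Gompf1998_thm13_noTwoHandles : Prop :=
  ∀ (W : Type) [TopologicalSpace W] [T2Space W] [SecondCountableTopology W] [CompactSpace W]
    [ChartedSpace (EuclideanHalfSpace 4) W] [IsManifold (𝓡∂ 4) ∞ W],
    Literature.Topology.FourManifolds.IsOrientable (𝓡∂ 4) W → Literature.Topology.FourManifolds.IsHandlebodyOfIndexLE 3 1 W → IsSteinDomain W

/-! ### API -/

/-- Under the fact, a compact oriented 4-manifold with boundary carrying a Morse function adapted
to the boundary without critical points of positive index (a disjoint union of 4-balls,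
Milnor 1963, Thm. 3.1/3.2) is a Stein domain. [cite: Gompf1998, Thm. 1.3] -/
theorem Gompf1998_thm13_noTwoHandles.of_indexLE_zero (h : Gompf1998_thm13_noTwoHandles)
    (W : Type) [TopologicalSpace W] [T2Space W] [SecondCountableTopology W] [CompactSpace W]
    [ChartedSpace (EuclideanHalfSpace 4) W] [IsManifold (𝓡∂ 4) ∞ W] (ho : Literature.Topology.FourManifolds.IsOrientable (𝓡∂ 4) W)
    (h0 : Literature.Topology.FourManifolds.IsHandlebodyOfIndexLE 3 0 W) : IsSteinDomain W :=
  h W ho (h0.mono zero_le_one)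

/-- The empty 4-manifold is a Stein domain (all fields of `SteinStructure` are vacuous); in
particular the fact holds for it (it is a handlebody with no handles,
`isHandlebodyOfIndexLE_of_isEmpty`). [folklore] -/
theorem isSteinDomain_of_isEmpty (W : Type*) [TopologicalSpace W]
    [ChartedSpace (EuclideanHalfSpace 4) W] [IsManifold (𝓡∂ 4) ∞ W] [CompactSpace W] [IsEmpty W] :
    IsSteinDomain W :=
  ⟨{ J := fun x => isEmptyElim x
     φ := fun x => isEmptyElim x
     J_sq := fun x => isEmptyElim x
     J_smooth := fun _ _ x => isEmptyElim x
     integrable := fun _ _ _ _ x => isEmptyElim x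
     φ_smooth := fun x => isEmptyElim x
     convex := fun x => isEmptyElim x
     boundary_eq := fun x => isEmptyElim x
     regular := fun x => isEmptyElim x }⟩

/-! ### The converse direction, condition (a): Stein domains are 2-handlebodies -/

/-- **Eliashberg's theorem, "only if" direction, condition (a): a compact Stein domain is a
2-handlebody.**  Gompf, *Handlebody construction of Stein surfaces*, Ann. of Math. 148 (1998),
Thm. 1.3 (Eliashberg 1990), compact case, as printed: *"A smooth, oriented, compact 4-manifold `X`
admits a Stein structure if and only if it has a handle decomposition satisfying a, b and c. In
either case, any such handle decomposition comes from a strictly plurisubharmonic function (with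
`∂X` a level set)"*, where *"(a) Each handle has index `≤ 2`"* ((b), (c) concern the Legendrian
attaching circles and framings of the 2-handles and are dropped here); Gompf's Stein domain is
*"a compact, complex `X` with boundary [admitting] a strictly plurisubharmonic function such that
the boundary `∂X` is a level set"* (ibid., §0), which is the tree's `SteinStructure`
(`SteinDomain.lean`: `J` integrable, `φ` strictly `J`-convex, `∂W = {φ = max φ}` a regular level
set).  The underlying facts are Eliashberg's (1990) / Milnor's: a generic `J`-convex function is
Morse (J-convexity is `C²`-open), and a `J`-convex Morse function on a complex surface has no
critical point of index `> 2` (the Levi form is positive on every complex line).  Tree rendering: a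
compact (Hausdorff, second countable) `C^∞` 4-manifold with boundary `W` (model `𝓡∂ 4`) admitting
a Stein structure (`IsSteinDomain W`) carries a Morse function adapted to `∂W` all of whose
critical points have index `≤ 2` (`Literature.Topology.FourManifolds.IsHandlebodyOfIndexLE 3 2 W`,
the Morse-theoretic form of "has a handle decomposition with all handles of index `≤ 2`",
Milnor 1963 Thm. 3.2, Kosinski 1993 VII (1.2)).  Companion of `Gompf1998_thm13_noTwoHandles`
(the "if" direction without 2-handles).  Wanted by the SPC4 crux `ContractibleTwistedDoubleStandard`
(route ConvexBisection, line `legendrian-r-knot-rigidity`, registered stub `stub_steinTwoHandlebody`,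
whose statement is this body verbatim). [cite: Gompf1998, Thm. 1.3 (compact case, only if, condition (a))] -/
def Gompf1998_thm13_indexLE_two : Prop :=
  ∀ (W : Type) [TopologicalSpace W] [T2Space W] [SecondCountableTopology W] [CompactSpace W]
    [ChartedSpace (EuclideanHalfSpace 4) W] [IsManifold (𝓡∂ 4) ∞ W],
    IsSteinDomain W → Literature.Topology.FourManifolds.IsHandlebodyOfIndexLE 3 2 W

/-- Under the fact, a compact 4-manifold with boundary carrying a `SteinStructure` is a
2-handlebody (unbundled form consumed by the SPC4 stubs). [cite: Gompf1998, Thm. 1.3] -/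
theorem Gompf1998_thm13_indexLE_two.of_steinStructure (h : Gompf1998_thm13_indexLE_two)
    (W : Type) [TopologicalSpace W] [T2Space W] [SecondCountableTopology W] [CompactSpace W]
    [ChartedSpace (EuclideanHalfSpace 4) W] [IsManifold (𝓡∂ 4) ∞ W] (S : SteinStructure W) :
    Literature.Topology.FourManifolds.IsHandlebodyOfIndexLE 3 2 W :=
  h W ⟨S⟩

/-- The fact holds for the empty 4-manifold (a handlebody with no handles,
`isHandlebodyOfIndexLE_of_isEmpty`). [folklore] -/
theorem Gompf1998_thm13_indexLE_two.isEmpty_case (W : Type) [TopologicalSpace W]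
    [ChartedSpace (EuclideanHalfSpace 4) W] [IsEmpty W] :
    Literature.Topology.FourManifolds.IsHandlebodyOfIndexLE 3 2 W :=
  Literature.Topology.FourManifolds.isHandlebodyOfIndexLE_of_isEmpty

/-! ### Discharge of `Gompf1998_thm13_indexLE_two` -/

/-- **A compact 4-manifold with boundary carrying a Stein structure is a 2-handlebody**
(Gompf 1998, Thm. 1.3 (Eliashberg 1990), compact case, "only if", condition (a); any
universe).  Proof: the Stein structure `S` yields a Morse function `g` adapted to `∂W` which
is strictly `J`-convex for `S.J` (`SteinStructure.exists_isMorseAdapted_levi_pos`,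
`SteinMorsePerturbation.lean`: affine rescaling of `S.φ` and Milnor's density theorem run
with `J`-convexity as an invariant); its critical points are interior (it is regular on
`∂W`), and at an interior critical point a strictly `J`-convex function has Morse index `≤ 2`
(`SteinStructure.isHandlebodyOfIndexLE_two_of_isMorseAdapted`, `SteinMorseIndex.lean`: the
Levi form is positive on complex lines, so a negative definite subspace of the Hessian is
disjoint from its `J`-image). [cite: Gompf1998, Thm. 1.3 (compact case, only if, condition (a))] -/
theorem SteinStructure.isHandlebodyOfIndexLE_two {W : Type*} [TopologicalSpace W] [T2Space W]
    [CompactSpace W] [ChartedSpace (EuclideanHalfSpace 4) W] [IsManifold (𝓡∂ 4) ∞ W]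
    (S : SteinStructure W) : Literature.Topology.FourManifolds.IsHandlebodyOfIndexLE 3 2 W := by
  obtain ⟨g, hg, hconv⟩ := S.exists_isMorseAdapted_levi_pos
  exact S.isHandlebodyOfIndexLE_two_of_isMorseAdapted hg hconv

/-- **A compact Stein domain is a 2-handlebody** (unconditional form of the named fact, any
universe). [cite: Gompf1998, Thm. 1.3 (compact case, only if, condition (a))] -/
theorem IsSteinDomain.isHandlebodyOfIndexLE_two {W : Type*} [TopologicalSpace W] [T2Space W]
    [CompactSpace W] [ChartedSpace (EuclideanHalfSpace 4) W] [IsManifold (𝓡∂ 4) ∞ W]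
    (h : IsSteinDomain W) : Literature.Topology.FourManifolds.IsHandlebodyOfIndexLE 3 2 W := by
  obtain ⟨S⟩ := h
  exact S.isHandlebodyOfIndexLE_two

/-- **Discharge of the named fact `Gompf1998_thm13_indexLE_two`** (Gompf 1998, Thm. 1.3
(Eliashberg 1990), compact case, "only if", condition (a): a compact Stein domain carries a
Morse function adapted to the boundary all of whose critical points have index `≤ 2`).
[cite: Gompf1998, Thm. 1.3 (compact case, only if, condition (a))] -/
theorem Gompf1998_thm13_indexLE_two_holds : Gompf1998_thm13_indexLE_two :=
  fun _ _ _ _ _ _ _ h => h.isHandlebodyOfIndexLE_two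

end Literature.Geometry.Symplectic

end
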